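import Summits.QuantumFields.YangMills.Theorems.SourcedPressureJensenSourcedPressureIncrementCurvatureDecay
import HarnessLib

/-!
# `SourcedPressureIncrement` (stmt-QuantumFields-22517), uniform stability (1/3): the curvature covariance is a
# CONTRACTION on every finite family of parallel plaquettes

For the two-plaquette kernel `curvatureTwoPoint = (d(-Δ)⁻¹d*)` of the lattice Maxwell field strength on `ℤ^d`
(`d ≥ 3`, `CurvatureGaussianField.lean`) and any orientation `i < j`:

* `sum_sum_mul_mul_curvatureTwoPoint_parallel_le` — for every finite family of sites `g : J → ℤ^d` and coefficients
  `c : J → ℝ`, `Σⱼⱼ' cⱼ cⱼ' C((gⱼ; i,j), (gⱼ'; i,j)) ≤ Σⱼⱼ' [gⱼ = gⱼ'] cⱼ cⱼ'`; for injective `g` the right side is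
  `Σⱼ cⱼ²` (`…_le_sum_sq`), and on a `Finset` of sites `Σ_{x,y∈B} c_x c_y C(x,y) ≤ Σ_{x∈B} c_x²`
  (`sum_sum_curvatureTwoPoint_parallel_le_sum_sq`);
* `sum_sum_curvatureCovKernel_parallel_le_sum_sq` — the same for the coloured kernel `curvatureCovKernel d D`
  (`δ_{ab} C(p,q)`) along any finite set of `(plaquette, colour)` indices of one orientation: every Gram matrix of the
  curvature Gaussian field on parallel plaquettes has operator norm `≤ 1`, UNIFORMLY in the family.

Mechanism (discrete Hodge, no Fourier analysis): by `curvatureTwoPoint_parallel_eq`,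
`C((x;i,j),(y;i,j)) = −[ΔᵢG + ΔⱼG](x−y)/2` with `G = latticeGreen`; for every direction `m` the form
`Σ cⱼcⱼ' (−Δ_m G)(gⱼ−gⱼ')/2` is the `G/2`-form of the DOUBLED family `(gⱼ, +cⱼ), (gⱼ+e_m, −cⱼ)`, hence `≥ 0` by the tree's
`sum_sum_mul_mul_half_latticeGreen_nonneg` (Bochner positivity of the Green function); summing over ALL `m` gives
`Σ cⱼcⱼ' (−ΔG)(gⱼ−gⱼ')/2 = Σ cⱼcⱼ' [gⱼ = gⱼ']` by the Poisson identity `ΔG = −2δ₀`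
(`latticeLaplacianZd_latticeGreen`), and the two directions `i, j` are a sub-sum of nonnegative terms.  (This is
`d Γ d* ≤ Γ(dd* + d*d) = 1` on `2`-forms, restricted to one orientation.)

Use: the volume-UNIFORM small-`h` exponential integrability of the quadratic plaquette energy `Σ_{x∈B} |Y(p₁₂x)|²` under
`curvatureGaussianField 4 D` (stub `stub_gauss` of crux `SourcedPressureIncrement`, and its cold-box child
`ColdBoxSourcedPressure` stmt-QuantumFields-23807: stability step of any cumulant/cluster expansion in the source strength
`h`).  Literature-only imports.  Everything is proved; no definition, no named fact.  RECORD-label rung support; the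
Yang–Mills mass gap is NOT proved by anything here. [folklore]
-/

noncomputable section

open Finset
open Literature.Probability.LatticeModels Literature.MathematicalPhysics.QuantumLattice
open Literature.MathematicalPhysics.QuantumFieldTheory

namespace Summit.QuantumFields.YangMills.Cruxes.SourcedPressureIncrement.Birth

variable {d : ℕ}

/-- The `G/2`-form of the doubled family `(gⱼ, cⱼ), (gⱼ + e_m, −cⱼ)` is the form of the directional second
difference: `Σ_{a,b ∈ J ⊕ J} c'_a c'_b G(g'_a − g'_b)/2 = Σⱼⱼ' cⱼ cⱼ' · (2G(z) − G(z+e_m) − G(z−e_m))/2`,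
`z = gⱼ − gⱼ'`. [folklore] -/
theorem sum_sum_doubled_family_eq {J : Type*} [Fintype J] (g : J → Site d) (c : J → ℝ) (m : Fin d) :
    ∑ a : J ⊕ J, ∑ b : J ⊕ J,
        Sum.elim c (fun j => -c j) a * Sum.elim c (fun j => -c j) b *
          (latticeGreen (Sum.elim g (fun j => g j + Pi.single m 1) a - Sum.elim g (fun j => g j + Pi.single m 1) b) / 2) =
      ∑ j, ∑ j', c j * c j' *
        ((2 * latticeGreen (g j - g j') - latticeGreen (g j - g j' + Pi.single m 1) -
            latticeGreen (g j - g j' - Pi.single m 1)) / 2) := by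
  simp only [Fintype.sum_sum_type, Sum.elim_inl, Sum.elim_inr]
  have e1 : ∀ j j' : J, g j + Pi.single m 1 - (g j' + Pi.single m 1) = g j - g j' := fun j j' => by abel
  have e2 : ∀ j j' : J, g j + Pi.single m 1 - g j' = g j - g j' + Pi.single m 1 := fun j j' => by abel
  have e3 : ∀ j j' : J, g j - (g j' + Pi.single m 1) = g j - g j' - Pi.single m 1 := fun j j' => by abel
  simp only [e1, e2, e3, ← Finset.sum_add_distrib]
  refine Finset.sum_congr rfl fun j _ => Finset.sum_congr rfl fun j' _ => ?_
  ring

/-- **Directional second differences of the Green function are negative-type kernels**: for every direction `m`,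
`0 ≤ Σⱼⱼ' cⱼ cⱼ' (2G(z) − G(z+e_m) − G(z−e_m))/2` (`z = gⱼ − gⱼ'`, `G = latticeGreen`, `d ≥ 3`) — the `G/2`-form of the
doubled family, nonnegative by Bochner positivity of `G` (`sum_sum_mul_mul_half_latticeGreen_nonneg`). [folklore] -/
theorem sum_sum_mul_mul_second_diff_nonneg (hd : 3 ≤ d) {J : Type*} [Fintype J] (g : J → Site d) (c : J → ℝ)
    (m : Fin d) :
    0 ≤ ∑ j, ∑ j', c j * c j' *
        ((2 * latticeGreen (g j - g j') - latticeGreen (g j - g j' + Pi.single m 1) -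
            latticeGreen (g j - g j' - Pi.single m 1)) / 2) := by
  rw [← sum_sum_doubled_family_eq g c m]
  exact sum_sum_mul_mul_half_latticeGreen_nonneg hd (J ⊕ J) _ _

/-- Summing the directional second-difference forms over ALL directions gives the diagonal form:
`Σ_m Σⱼⱼ' cⱼ cⱼ' (2G(z) − G(z+e_m) − G(z−e_m))/2 = Σⱼⱼ' [gⱼ = gⱼ'] cⱼ cⱼ'` (Poisson identity `ΔG = −2δ₀`,
`latticeLaplacianZd_latticeGreen`, `d ≥ 3`). [folklore] -/
theorem sum_univ_sum_sum_second_diff_eq (hd : 3 ≤ d) {J : Type*} [Fintype J] (g : J → Site d) (c : J → ℝ) :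
    ∑ m : Fin d, ∑ j, ∑ j', c j * c j' *
        ((2 * latticeGreen (g j - g j') - latticeGreen (g j - g j' + Pi.single m 1) -
            latticeGreen (g j - g j' - Pi.single m 1)) / 2) =
      ∑ j, ∑ j', if g j = g j' then c j * c j' else 0 := by
  rw [Finset.sum_comm]
  refine Finset.sum_congr rfl fun j _ => ?_
  rw [Finset.sum_comm]
  refine Finset.sum_congr rfl fun j' _ => ?_
  rw [← Finset.mul_sum]
  have hΔ := latticeLaplacianZd_latticeGreen d hd (g j - g j')
  rw [latticeLaplacianZd_def] at hΔ
  have hsum : ∑ m : Fin d, (2 * latticeGreen (g j - g j') - latticeGreen (g j - g j' + Pi.single m 1) -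
        latticeGreen (g j - g j' - Pi.single m 1)) / 2 = if g j - g j' = 0 then 1 else 0 := by
    have : ∑ m : Fin d, (2 * latticeGreen (g j - g j') - latticeGreen (g j - g j' + Pi.single m 1) -
          latticeGreen (g j - g j' - Pi.single m 1)) / 2 =
        (2 * d * latticeGreen (g j - g j') -
            ∑ m : Fin d, (latticeGreen (g j - g j' + Pi.single m 1) + latticeGreen (g j - g j' - Pi.single m 1))) / 2 := by
      rw [Finset.sum_add_distrib, ← Finset.sum_div, Finset.sum_sub_distrib, Finset.sum_sub_distrib, Finset.sum_const,
        Finset.card_univ, Fintype.card_fin]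
      simp only [nsmul_eq_mul]
      ring
    have h' : ∑ m : Fin d, (latticeGreen (g j - g j' + Pi.single m 1) + latticeGreen (g j - g j' - Pi.single m 1)) =
        2 * d * latticeGreen (g j - g j') + -2 * (if g j - g j' = 0 then 1 else 0) := by
      linarith [hΔ]
    rw [this, h']
    ring
  rw [hsum]
  by_cases h : g j = g j'
  · simp [h]
  · have h2 : g j - g j' ≠ 0 := sub_ne_zero.mpr h
    simp [h, h2]

/-- **The curvature covariance is a contraction on parallel plaquettes (family form).**  For `d ≥ 3`, an orientation
`i < j`, a finite family of sites `g : J → ℤ^d` and coefficients `c`,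
`Σⱼⱼ' cⱼ cⱼ' · curvatureTwoPoint (gⱼ; i,j) (gⱼ'; i,j) ≤ Σⱼⱼ' [gⱼ = gⱼ'] cⱼ cⱼ'` (discrete Hodge bound
`dΓd* ≤ 1` on one orientation: the `i`- and `j`-directional forms are two of the `d` nonnegative directional forms whose
sum is the diagonal form). [folklore] -/
theorem sum_sum_mul_mul_curvatureTwoPoint_parallel_le (hd : 3 ≤ d) (ij : {p : Fin d × Fin d // p.1 < p.2})
    {J : Type*} [Fintype J] (g : J → Site d) (c : J → ℝ) :
    ∑ j, ∑ j', c j * c j' * curvatureTwoPoint ((g j, ij) : ZdPlaquette d) (g j', ij) ≤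
      ∑ j, ∑ j', if g j = g j' then c j * c j' else 0 := by
  -- the directional forms
  set T : Fin d → ℝ := fun m => ∑ j, ∑ j', c j * c j' *
      ((2 * latticeGreen (g j - g j') - latticeGreen (g j - g j' + Pi.single m 1) -
          latticeGreen (g j - g j' - Pi.single m 1)) / 2) with hT
  have hTnn : ∀ m, 0 ≤ T m := fun m => sum_sum_mul_mul_second_diff_nonneg hd g c m
  have hTsum : ∑ m, T m = ∑ j, ∑ j', if g j = g j' then c j * c j' else 0 :=
    sum_univ_sum_sum_second_diff_eq hd g c
  -- the curvature form is `T i + T j`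
  have hC : ∑ j, ∑ j', c j * c j' * curvatureTwoPoint ((g j, ij) : ZdPlaquette d) (g j', ij) = T ij.1.1 + T ij.1.2 := by
    simp only [hT, ← Finset.sum_add_distrib]
    refine Finset.sum_congr rfl fun j _ => Finset.sum_congr rfl fun j' _ => ?_
    rw [curvatureTwoPoint_parallel_eq]
    ring
  rw [hC, ← hTsum]
  have hne : ij.1.1 ≠ ij.1.2 := ne_of_lt ij.2
  calc T ij.1.1 + T ij.1.2 = ∑ m ∈ ({ij.1.1, ij.1.2} : Finset (Fin d)), T m := by
        rw [Finset.sum_pair hne]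
    _ ≤ ∑ m, T m := Finset.sum_le_sum_of_subset_of_nonneg (Finset.subset_univ _) fun m _ _ => hTnn m

/-- **Positivity** of the same form (it is the sum of two nonnegative directional forms). [folklore] -/
theorem sum_sum_mul_mul_curvatureTwoPoint_parallel_nonneg (hd : 3 ≤ d) (ij : {p : Fin d × Fin d // p.1 < p.2})
    {J : Type*} [Fintype J] (g : J → Site d) (c : J → ℝ) :
    0 ≤ ∑ j, ∑ j', c j * c j' * curvatureTwoPoint ((g j, ij) : ZdPlaquette d) (g j', ij) := by
  have hC : ∑ j, ∑ j', c j * c j' * curvatureTwoPoint ((g j, ij) : ZdPlaquette d) (g j', ij) =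
      (∑ j, ∑ j', c j * c j' *
        ((2 * latticeGreen (g j - g j') - latticeGreen (g j - g j' + Pi.single ij.1.1 1) -
            latticeGreen (g j - g j' - Pi.single ij.1.1 1)) / 2)) +
      ∑ j, ∑ j', c j * c j' *
        ((2 * latticeGreen (g j - g j') - latticeGreen (g j - g j' + Pi.single ij.1.2 1) -
            latticeGreen (g j - g j' - Pi.single ij.1.2 1)) / 2) := by
    simp only [← Finset.sum_add_distrib]
    refine Finset.sum_congr rfl fun j _ => Finset.sum_congr rfl fun j' _ => ?_
    rw [curvatureTwoPoint_parallel_eq]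
    ring
  rw [hC]
  exact add_nonneg (sum_sum_mul_mul_second_diff_nonneg hd g c _) (sum_sum_mul_mul_second_diff_nonneg hd g c _)

/-- **Injective families**: `Σⱼⱼ' cⱼ cⱼ' C((gⱼ;i,j),(gⱼ';i,j)) ≤ Σⱼ cⱼ²`. [folklore] -/
theorem sum_sum_mul_mul_curvatureTwoPoint_parallel_le_sum_sq (hd : 3 ≤ d) (ij : {p : Fin d × Fin d // p.1 < p.2})
    {J : Type*} [Fintype J] {g : J → Site d} (hg : Function.Injective g) (c : J → ℝ) :
    ∑ j, ∑ j', c j * c j' * curvatureTwoPoint ((g j, ij) : ZdPlaquette d) (g j', ij) ≤ ∑ j, c j ^ 2 := by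
  classical
  refine (sum_sum_mul_mul_curvatureTwoPoint_parallel_le hd ij g c).trans (le_of_eq ?_)
  refine Finset.sum_congr rfl fun j _ => ?_
  rw [Finset.sum_eq_single j]
  · simp [sq]
  · intro j' _ hj'
    rw [if_neg fun h => hj' (hg h).symm]
  · intro h; exact absurd (Finset.mem_univ j) h

/-- **Finset form**: for a finite set of sites `B ⊂ ℤ^d` and any coefficients,
`Σ_{x∈B} Σ_{y∈B} c_x c_y · curvatureTwoPoint (x;i,j) (y;i,j) ≤ Σ_{x∈B} c_x²` — the covariance matrix of the curvature
field on the parallel plaquettes over `B` is `≤ 1` as a quadratic form, uniformly in `B`. [folklore] -/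
theorem sum_sum_curvatureTwoPoint_parallel_le_sum_sq (hd : 3 ≤ d) (ij : {p : Fin d × Fin d // p.1 < p.2})
    (B : Finset (Site d)) (c : Site d → ℝ) :
    ∑ x ∈ B, ∑ y ∈ B, c x * c y * curvatureTwoPoint ((x, ij) : ZdPlaquette d) (y, ij) ≤ ∑ x ∈ B, c x ^ 2 := by
  have h := sum_sum_mul_mul_curvatureTwoPoint_parallel_le_sum_sq hd ij (J := B) (g := fun x : B => (x : Site d))
    Subtype.coe_injective (fun x => c x)
  calc ∑ x ∈ B, ∑ y ∈ B, c x * c y * curvatureTwoPoint ((x, ij) : ZdPlaquette d) (y, ij)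
      = ∑ x : B, ∑ y : B, c x * c y * curvatureTwoPoint (((x : Site d), ij) : ZdPlaquette d) ((y : Site d), ij) := by
        rw [← Finset.sum_coe_sort B]
        exact Finset.sum_congr rfl fun x _ => by rw [← Finset.sum_coe_sort B]
    _ ≤ ∑ x : B, c x ^ 2 := h
    _ = ∑ x ∈ B, c x ^ 2 := Finset.sum_coe_sort B (fun x => c x ^ 2)

/-- **Coloured kernel, one orientation**: for every finite set `I` of `(plaquette, colour)` indices all of orientation
`(i, j)` and every `v : I → ℝ`, `Σ_{s,t∈I} v_s v_t · curvatureCovKernel d D s t ≤ Σ_s v_s²` — every Gram matrix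
`covGram (curvatureCovKernel d D) I` of the curvature Gaussian field on parallel plaquettes is `≤ 1` as a quadratic
form (colours are independent copies: `K((p,a),(q,b)) = δ_{ab} C(p,q)`). [folklore] -/
theorem sum_sum_curvatureCovKernel_parallel_le_sum_sq (hd : 3 ≤ d) (D : ℕ) (ij : {p : Fin d × Fin d // p.1 < p.2})
    (I : Finset (ZdPlaquette d × Fin D)) (hI : ∀ s ∈ I, s.1.2 = ij) (v : I → ℝ) :
    ∑ s : I, ∑ t : I, v s * v t * curvatureCovKernel d D s t ≤ ∑ s : I, v s ^ 2 := by
  classical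
  -- split by colour: `K s t = Σ_a [s.2 = a][t.2 = a] C(s.1, t.1)`
  have hK : ∀ s t : I, v s * v t * curvatureCovKernel d D s t =
      ∑ a : Fin D, (if (s : ZdPlaquette d × Fin D).2 = a then v s else 0) *
        (if (t : ZdPlaquette d × Fin D).2 = a then v t else 0) *
          curvatureTwoPoint (((s : ZdPlaquette d × Fin D).1.1, ij) : ZdPlaquette d)
            ((t : ZdPlaquette d × Fin D).1.1, ij) := by
    intro s t
    have hs : ((s : ZdPlaquette d × Fin D).1.1, ij) = (s : ZdPlaquette d × Fin D).1 := by
      rw [← hI s s.2]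
    have ht : ((t : ZdPlaquette d × Fin D).1.1, ij) = (t : ZdPlaquette d × Fin D).1 := by
      rw [← hI t t.2]
    rw [hs, ht]
    simp only [curvatureCovKernel]
    by_cases hst : (s : ZdPlaquette d × Fin D).2 = (t : ZdPlaquette d × Fin D).2
    · rw [if_pos hst, Finset.sum_eq_single (t : ZdPlaquette d × Fin D).2]
      · simp [hst]
      · intro a _ ha
        rw [if_neg (Ne.symm ha)]; ring
      · intro h; exact absurd (Finset.mem_univ _) h
    · rw [if_neg hst]
      simp only [mul_zero]
      symm
      refine Finset.sum_eq_zero fun a _ => ?_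
      by_cases h1 : (s : ZdPlaquette d × Fin D).2 = a
      · rw [if_pos h1, if_neg (fun h2 : (t : ZdPlaquette d × Fin D).2 = a => hst (h1.trans h2.symm))]; ring
      · rw [if_neg h1]; ring
  simp_rw [hK]
  have hswap : ∑ s : I, ∑ t : I, ∑ a : Fin D, (if (s : ZdPlaquette d × Fin D).2 = a then v s else 0) *
        (if (t : ZdPlaquette d × Fin D).2 = a then v t else 0) *
          curvatureTwoPoint (((s : ZdPlaquette d × Fin D).1.1, ij) : ZdPlaquette d)
            ((t : ZdPlaquette d × Fin D).1.1, ij) =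
      ∑ a : Fin D, ∑ s : I, ∑ t : I, (if (s : ZdPlaquette d × Fin D).2 = a then v s else 0) *
        (if (t : ZdPlaquette d × Fin D).2 = a then v t else 0) *
          curvatureTwoPoint (((s : ZdPlaquette d × Fin D).1.1, ij) : ZdPlaquette d)
            ((t : ZdPlaquette d × Fin D).1.1, ij) := by
    exact (Finset.sum_congr rfl fun s _ => Finset.sum_comm).trans Finset.sum_comm
  rw [hswap]
  -- now `Σ_a Σ_s Σ_t …`; bound each colour by the family bound
  have hcol : ∀ a : Fin D,
      ∑ s : I, ∑ t : I, (if (s : ZdPlaquette d × Fin D).2 = a then v s else 0) *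
        (if (t : ZdPlaquette d × Fin D).2 = a then v t else 0) *
          curvatureTwoPoint (((s : ZdPlaquette d × Fin D).1.1, ij) : ZdPlaquette d)
            ((t : ZdPlaquette d × Fin D).1.1, ij) ≤
      ∑ s : I, (if (s : ZdPlaquette d × Fin D).2 = a then v s else 0) ^ 2 := by
    intro a
    refine (sum_sum_mul_mul_curvatureTwoPoint_parallel_le hd ij
      (fun s : I => (s : ZdPlaquette d × Fin D).1.1) _).trans (le_of_eq ?_)
    refine Finset.sum_congr rfl fun s _ => ?_
    rw [Finset.sum_eq_single s]
    · rw [if_pos rfl, sq]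
    · intro t _ hts
      by_cases hsite : (s : ZdPlaquette d × Fin D).1.1 = (t : ZdPlaquette d × Fin D).1.1
      · rw [if_pos hsite]
        by_cases hsa : (s : ZdPlaquette d × Fin D).2 = a
        · by_cases hta : (t : ZdPlaquette d × Fin D).2 = a
          · exfalso
            apply hts
            apply Subtype.ext
            refine Prod.ext (Prod.ext hsite.symm ?_) (hta.trans hsa.symm)
            rw [hI t t.2, hI s s.2]
          · rw [if_neg hta]; ring
        · rw [if_neg hsa]; ring
      · rw [if_neg hsite]
    · intro h; exact absurd (Finset.mem_univ s) h
  calc ∑ a : Fin D, ∑ s : I, ∑ t : I, (if (s : ZdPlaquette d × Fin D).2 = a then v s else 0) *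
        (if (t : ZdPlaquette d × Fin D).2 = a then v t else 0) *
          curvatureTwoPoint (((s : ZdPlaquette d × Fin D).1.1, ij) : ZdPlaquette d)
            ((t : ZdPlaquette d × Fin D).1.1, ij)
      ≤ ∑ a : Fin D, ∑ s : I, (if (s : ZdPlaquette d × Fin D).2 = a then v s else 0) ^ 2 :=
        Finset.sum_le_sum fun a _ => hcol a
    _ = ∑ s : I, v s ^ 2 := by
        rw [Finset.sum_comm]
        refine Finset.sum_congr rfl fun s _ => ?_
        rw [Finset.sum_eq_single (s : ZdPlaquette d × Fin D).2]
        · simp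
        · intro a _ ha; rw [if_neg (Ne.symm ha)]; ring
        · intro h; exact absurd (Finset.mem_univ _) h

end Summit.QuantumFields.YangMills.Cruxes.SourcedPressureIncrement.Birth

end
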